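import Summits.CriticalPhenomena.PercolationContinuityZ3.Theorems.Transplant.SkelPhiFaceRouteReadings
import Summits.CriticalPhenomena.PercolationContinuityZ3.Theorems.Transplant.KNParaRootBridge
import HarnessLib

/-!
# N1 ({±1} node), (F) inner route, part R5a″-y (hp-8 g35): **THE PER-CENTRE NUMBERS OF A y′-FACE ROUTE, v4** — `FaceRunNums3` (p305523) specialised
# to y′-faces (`(along, tangential) = (yRunSched in runY φ c_L σ, xRunSched in runX φ c_T σ_T)`; the `isX` flag and the x-readings dropped) under the
# rulings of 2026-08-22 (lane INBOX 01:45:32Z p3-g11: (L-F1) := (ii) the wide y′-face bridge pair with HOP SIDE `σh := σ·sgn⁺ v_α` — p1-g13's recession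
# lemma —, (L-F5), frames convention 'B(σh)-frame, origin absolute, ONE relative sign σ·σh in the cross link'): a new parameter `σh` (the hop side; the
# bridge `B` lives in `rootFrame φ c σh`), the cross-link readings `hxa/hxb` in the two-sign shapes of p1-g13's `runY_core_zero_of_bridge_core` (p313592),
# and the seed clearances of the two bands in the SERVED, SEED-GENERIC form `∀ S, (∀ s ∈ S, φ s − φ c ∈ box 2 Mz) → ∀ k ≤ N, ∀ w, ψ w ∈ region k → w ∉ S`
# (fields `hclrA` — dischargeable by the signed α-readings `yRun_region_clear_alpha_lo/_hi` from the bridge offset —, `hclrT` — by the LEVEL reading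
# `xRun_region_clear_level`, (L-F5): the tangential x-run re-crosses the seed column one band above the contact); `Mz` replaces `kb`.
builds on p205010 (kernel theorem, internal audit signed; external expert review pending) — nothing in this file uses p205010; no claim about the open node.
Lane `prim-bschramm`, seat `prim-hp-8` (gen 35); helper file (`--supports stmt-CriticalPhenomena-4575 --as helper`).
* **`Skelφ.FaceRunNumsY4`** (structure).
[cite: KozmaNitzan2024, §4 Lemma 11 (pp. 22–23), Lemma 12 (pp. 23–25)] [cite: MartineauTassion2017, §4.3 Lemma 4.2]
-/

noncomputable section

open scoped Classical

namespace Summit.CriticalPhenomena.PercolationContinuityZ3.Theorems.Transplant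

namespace Skelφ

open Literature.Probability.Percolation Literature.Probability.LatticeModels SimpleGraph KNCells
open Literature.Probability.Percolation.KozmaNitzan.Cells (oth sgOf)
open KNLevels ChainPlanar ChainPara
open Literature.Barriers.CriticalPhenomena (graphBall)
open TwoAxis.Para (modulus)

variable {V : Type} [DecidableEq V]

/-- **THE PER-CENTRE NUMBERS OF A y′-FACE ROUTE, v4** at the kit centre `c` (bridge in `rootFrame φ c σh`, along y′-run in `runY φ cL … σ`,
tangential x-run in `runX φ cT … σT`; seed clearances in the served seed-generic form; see the module docstring).
[cite: KozmaNitzan2024, §4 Lemma 11 (pp. 22–23), Lemma 12 (pp. 23–25)] -/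
structure FaceRunNumsY4 (G : SimpleGraph V) [G.LocallyFinite] (φ ψc : V → Site 2) (c : V) (Af : ℤ) (nL : ℕ) (hL vα vβ c0f c1f Df : ℤ)
    (du : MDir) (σh σ : ℤ) (B : BridgePrm) (ℓ' R's qB R'₃ qB₃ : ℕ) (vL : ℤ) (hnL : 1 ≤ nL) (hvL : |vL| ≤ nL)
    (hlay : (nL + hL.natAbs : ℕ) ≤ (nL : ℤ) * ℓ' + 1) (Mz : ℕ) (Pl : Finset (Site 2)) (MM Zc : Finset V) (L : ℕ) (kpar kperp : ℤ) where
  /-- along origin -/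
  cL : V
  /-- tangential origin -/
  cT : V
  /-- `φ cL = φ c + yL` -/
  yL : Site 2
  /-- `φ cT = φ c + yT` -/
  yT : Site 2
  /-- reach of `cL` -/
  RcL : ℕ
  /-- reach of `cT` -/
  RcT : ℕ
  /-- along stride count -/
  Nr : ℕ
  /-- tangential stride count -/
  N₃ : ℕ
  /-- tangential sign -/
  σT : ℤ
  /-- habitat footprint box -/
  flo : ℤ
  /-- habitat footprint box -/
  fhi : ℤ
  /-- habitat footprint box -/
  fw : ℤ
  /-- along prism box -/
  paLo : ℕ → ℤ
  /-- along prism box -/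
  pbLo : ℕ → ℤ
  /-- along prism box -/
  paHi : ℕ → ℤ
  /-- along prism box -/
  pbHi : ℕ → ℤ
  /-- along prism fine reading -/
  PLO : ℕ → Site 2
  /-- along prism fine reading -/
  PHI : ℕ → Site 2
  /-- tangential prism box -/
  yaLo : ℕ → ℤ
  /-- tangential prism box -/
  ybLo : ℕ → ℤ
  /-- tangential prism box -/
  yaHi : ℕ → ℤ
  /-- tangential prism box -/
  ybHi : ℕ → ℤ
  /-- last core box -/
  laLo : ℤ
  /-- last core box -/
  lbLo : ℤ
  /-- last core box -/
  laHi : ℤ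
  /-- last core box -/
  lbHi : ℤ
  /-- tangential prism fine reading -/
  YLO : ℕ → Site 2
  /-- tangential prism fine reading -/
  YHI : ℕ → Site 2
  /-- last core fine reading -/
  LLO : Site 2
  /-- last core fine reading -/
  LHI : Site 2
  hcLφ : φ cL = φ c + yL
  hcTφ : φ cT = φ c + yT
  hcLπ : cL ∈ graphBall G c RcL
  hcTπ : cT ∈ graphBall G c RcT
  hσT : σT = 1 ∨ σT = -1
  hPlfoot : ∀ w ∈ graphBall G c L, FootBox flo fhi fw du (fineSkel φ c Af nL hL vα vβ c0f c1f (Df / 2) (Df / 2) Df w) → ψc w ∈ Pl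
  hMfoot : ∀ w ∈ graphBall G c L, fineSkel φ c Af nL hL vα vβ c0f c1f (Df / 2) (Df / 2) Df w ∈ Finset.Icc LLO LHI → w ∈ MM
  hMZ : Disjoint MM Zc
  hfR : flo ≤ -kpar ∧ kpar ≤ fhi ∧ kperp ≤ fw
  hreg : ∀ k ≤ Nr, (yRunSched hnL hvL hlay R's qB Nr).region k ⊆
    Finset.Icc (pt (paLo k) (pbLo k)) (pt (paHi k) (pbHi k))
  hregY : ∀ k ≤ N₃, (xRunSched nL ℓ' hL R'₃ qB₃ N₃).region k ⊆
    Finset.Icc (pt (yaLo k) (ybLo k)) (pt (yaHi k) (ybHi k))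
  hlastc : (xRunSched nL ℓ' hL R'₃ qB₃ N₃).core (N₃ + 1) ⊆
    Finset.Icc (pt laLo lbLo) (pt laHi lbHi)
  /-- along prism reading, axis 0 low (`(pa, pb)` = (along, transverse) boxes of the y′-run in its frame, exchanged into the sign-unified x-frame) -/
  hP0 : ∀ k ≤ Nr, PLO k 0 ≤ TwoAxis.Para.coarse c0f (Df / 2) Df (TwoAxis.Para.lam0 Af vα vβ yL) +
    (c0f * (Af * (modulus nL hL vα vβ * (min (σ * pbLo k) (σ * pbHi k)) -
      max (vα * ((shearUnit nL hL : ℤ) * (min (σ * paLo k) (σ * paHi k) - 1)))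
        (vα * ((shearUnit nL hL : ℤ) * (max (σ * paLo k) (σ * paHi k)) + shearUnit nL hL - 1))) / nL)) / Df
  hP1 : ∀ k ≤ Nr, TwoAxis.Para.coarse c0f (Df / 2) Df (TwoAxis.Para.lam0 Af vα vβ yL) +
    (c0f * (Af * (modulus nL hL vα vβ * (max (σ * pbLo k) (σ * pbHi k)) -
      min (vα * ((shearUnit nL hL : ℤ) * (min (σ * paLo k) (σ * paHi k) - 1)))
        (vα * ((shearUnit nL hL : ℤ) * (max (σ * paLo k) (σ * paHi k)) + shearUnit nL hL - 1))) / nL)) / Df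
      + 1 ≤ PHI k 0
  hP2 : ∀ k ≤ Nr, PLO k 1 ≤ TwoAxis.Para.coarse c1f (Df / 2) Df (TwoAxis.Para.lam1 Af nL hL yL) +
    (c1f * (Af * ((shearUnit nL hL : ℤ) * (min (σ * paLo k) (σ * paHi k) - 1)))) / Df
  hP3 : ∀ k ≤ Nr, TwoAxis.Para.coarse c1f (Df / 2) Df (TwoAxis.Para.lam1 Af nL hL yL) +
    (c1f * (Af * ((shearUnit nL hL : ℤ) * (max (σ * paLo k) (σ * paHi k)) + shearUnit nL hL - 1))) / Df + 1
      ≤ PHI k 1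
  hPf₁ : ∀ k ≤ Nr, sgOf du = 1 → flo ≤ PLO k du.1 ∧ PHI k du.1 ≤ fhi
  hPf₂ : ∀ k ≤ Nr, sgOf du = -1 → flo ≤ -PHI k du.1 ∧ -PLO k du.1 ≤ fhi
  hPf₃ : ∀ k ≤ Nr, -fw ≤ PLO k (oth du.1) ∧ PHI k (oth du.1) ≤ fw
  hY0 : ∀ k ≤ N₃, YLO k 0 ≤ TwoAxis.Para.coarse c0f (Df / 2) Df (TwoAxis.Para.lam0 Af vα vβ yT) +
    (c0f * (Af * (modulus nL hL vα vβ * (min (σT * yaLo k) (σT * yaHi k)) -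
      max (vα * ((shearUnit nL hL : ℤ) * (min (σT * ybLo k) (σT * ybHi k) - 1)))
        (vα * ((shearUnit nL hL : ℤ) * (max (σT * ybLo k) (σT * ybHi k)) + shearUnit nL hL - 1))) / nL)) / Df
  hY1 : ∀ k ≤ N₃, TwoAxis.Para.coarse c0f (Df / 2) Df (TwoAxis.Para.lam0 Af vα vβ yT) +
    (c0f * (Af * (modulus nL hL vα vβ * (max (σT * yaLo k) (σT * yaHi k)) -
      min (vα * ((shearUnit nL hL : ℤ) * (min (σT * ybLo k) (σT * ybHi k) - 1)))
        (vα * ((shearUnit nL hL : ℤ) * (max (σT * ybLo k) (σT * ybHi k)) + shearUnit nL hL - 1))) / nL)) / Df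
      + 1 ≤ YHI k 0
  hY2 : ∀ k ≤ N₃, YLO k 1 ≤ TwoAxis.Para.coarse c1f (Df / 2) Df (TwoAxis.Para.lam1 Af nL hL yT) +
    (c1f * (Af * ((shearUnit nL hL : ℤ) * (min (σT * ybLo k) (σT * ybHi k) - 1)))) / Df
  hY3 : ∀ k ≤ N₃, TwoAxis.Para.coarse c1f (Df / 2) Df (TwoAxis.Para.lam1 Af nL hL yT) +
    (c1f * (Af * ((shearUnit nL hL : ℤ) * (max (σT * ybLo k) (σT * ybHi k)) + shearUnit nL hL - 1))) / Df + 1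
      ≤ YHI k 1
  hYf₁ : ∀ k ≤ N₃, sgOf du = 1 → flo ≤ YLO k du.1 ∧ YHI k du.1 ≤ fhi
  hYf₂ : ∀ k ≤ N₃, sgOf du = -1 → flo ≤ -YHI k du.1 ∧ -YLO k du.1 ≤ fhi
  hYf₃ : ∀ k ≤ N₃, -fw ≤ YLO k (oth du.1) ∧ YHI k (oth du.1) ≤ fw
  hL0 : LLO 0 ≤ TwoAxis.Para.coarse c0f (Df / 2) Df (TwoAxis.Para.lam0 Af vα vβ yT) +
    (c0f * (Af * (modulus nL hL vα vβ * (min (σT * laLo) (σT * laHi)) -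
      max (vα * ((shearUnit nL hL : ℤ) * (min (σT * lbLo) (σT * lbHi) - 1)))
        (vα * ((shearUnit nL hL : ℤ) * (max (σT * lbLo) (σT * lbHi)) + shearUnit nL hL - 1))) / nL)) / Df
  hL1 : TwoAxis.Para.coarse c0f (Df / 2) Df (TwoAxis.Para.lam0 Af vα vβ yT) +
    (c0f * (Af * (modulus nL hL vα vβ * (max (σT * laLo) (σT * laHi)) -
      min (vα * ((shearUnit nL hL : ℤ) * (min (σT * lbLo) (σT * lbHi) - 1)))
        (vα * ((shearUnit nL hL : ℤ) * (max (σT * lbLo) (σT * lbHi)) + shearUnit nL hL - 1))) / nL)) / Df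
      + 1 ≤ LHI 0
  hL2 : LLO 1 ≤ TwoAxis.Para.coarse c1f (Df / 2) Df (TwoAxis.Para.lam1 Af nL hL yT) +
    (c1f * (Af * ((shearUnit nL hL : ℤ) * (min (σT * lbLo) (σT * lbHi) - 1)))) / Df
  hL3 : TwoAxis.Para.coarse c1f (Df / 2) Df (TwoAxis.Para.lam1 Af nL hL yT) +
    (c1f * (Af * ((shearUnit nL hL : ℤ) * (max (σT * lbLo) (σT * lbHi)) + shearUnit nL hL - 1))) / Df + 1
      ≤ LHI 1
  /-- cross link bridge (frame `rootFrame φ c σh`) → along y′-run (frame `runY φ cL … σ`), α-reading with the relative sign `σ·σh` -/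
  hxa : ∀ x ∈ Finset.Icc B.core1Lo B.core1Hi,
    -((((nL : ℤ) + vL).toNat : ℕ) : ℤ) ≤ σ * σh * x 0 - σ * yL 0 ∧ σ * σh * x 0 - σ * yL 0 ≤ ((((nL : ℤ) - vL).toNat : ℕ) : ℤ)
  /-- cross link bridge → along y′-run, sheared-height reading -/
  hxb : ∀ x ∈ Finset.Icc B.core1Lo B.core1Hi,
    |σ * ((nL : ℤ) * (x 1 - yL 1) - hL * (σh * x 0 - yL 0))| + shearUnit nL hL ≤ ((qB : ℤ) + 1) * shearUnit nL hL
  /-- cross link along y′-run → tangential x-run -/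
  hxy : ∀ a s : ℤ, (yPrmW nL ℓ' hL vL R's qB Nr).aLo (Nr + 1) ≤ s / (shearUnit nL hL : ℤ) →
    s / (shearUnit nL hL : ℤ) ≤ (yPrmW nL ℓ' hL vL R's qB Nr).aHi (Nr + 1) →
    (yPrmW nL ℓ' hL vL R's qB Nr).bLo (Nr + 1) ≤ a → a ≤ (yPrmW nL ℓ' hL vL R's qB Nr).bHi (Nr + 1) →
    (xPrmW nL ℓ' hL R'₃ qB₃ N₃).InCore 0 (σT * σ * a - σT * (yT - yL) 0)
      ((σT * σ * s - σT * ((nL : ℤ) * (yT - yL) 1 - hL * (yT - yL) 0)) / (shearUnit nL hL : ℤ))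
  /-- seed clearance of the along y′-run, served seed-generic form: every vertex read into a region lies off every seed in the box `Mz` about `c` -/
  hclrA : ∀ S : Finset V, (∀ s ∈ S, φ s - φ c ∈ box 2 Mz) → ∀ k ≤ Nr, ∀ w,
    runY φ cL nL hL σ w ∈ (yRunSched hnL hvL hlay R's qB Nr).region k → w ∉ S
  /-- seed clearance of the tangential x-run, served seed-generic form (dischargeable by the LEVEL reading `Skelφ.xRun_region_clear_level`) -/
  hclrT : ∀ S : Finset V, (∀ s ∈ S, φ s - φ c ∈ box 2 Mz) → ∀ k ≤ N₃, ∀ w, runX φ cT nL hL σT w ∈ (xRunSched nL ℓ' hL R'₃ qB₃ N₃).region k → w ∉ S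
  hπ2 : ∀ k ≤ Nr, RcL + (((((k + 1 : ℕ) : ℤ) * vL).natAbs +
    (((shearUnit nL hL : ℤ) * |((k + 1 : ℕ) : ℤ) * (yPrmW nL ℓ' hL vL R's qB Nr).sLo| + |hL| * |((k + 1 : ℕ) : ℤ) * vL| + shearUnit nL hL) / nL).natAbs + 1))
      ≤ L
  hπ3 : RcT + (N₃ + 1) * shearUnit nL hL ≤ L

end Skelφ

end Summit.CriticalPhenomena.PercolationContinuityZ3.Theorems.Transplant

end
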